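import Literature.NumberTheory.EllipticCurves.ZpExtensionEisensteinAdicTowerReadoutColimit
import Literature.NumberTheory.EllipticCurves.IwasawaEisensteinTwistCharInverseProofs
import Literature.NumberTheory.EllipticCurves.ZpExtensionEisensteinDVRSetting
import Literature.NumberTheory.EllipticCurves.AnticyclotomicSignedCompactSelmer
import Literature.NumberTheory.EllipticCurves.SelmerTorsionInclusion
import Literature.NumberTheory.EllipticCurves.IwasawaSelmer
import HarnessLib

/-!
# The readout `H¹(K, A_𝔮) → H¹(K_∞, E[p^∞])` for the curve (`A_𝔮 = colim_k E[p^{k+1}] ⊗ A_{m,k+1}(ψ⁻¹)`)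

Topic `NumberTheory/EllipticCurves` (sequel to `ZpExtensionEisensteinAdicTowerReadoutColimit` (generic `eisensteinTowerReadout`),
`IwasawaEisensteinTwistCharInverseProofs` (the dictionary hypotheses for `κ⁻ = κ.unitTwist (-1)` and `E[n]`) and
`ZpExtensionEisensteinDVRSetting` (`W.eisensteinTower`, D1's tower of the curve); cell `pub/bsd-print-x9`, blueprint
HOME/p2/S1-DISCRETE-CONTROL §1(e): instantiation for `St = W.eisensteinDVRSetting (κ.unitTwist (-1)) hm …`).
One definition with body and theorems; no named fact, no instance, no `sorry`.

* `WeierstrassCurve.geomTorsion_pow_nsmul_eq_zero`: `p^k · E[p^k] = 0`; `torsionIncl_torsionGaloisModuleReduce`: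
  `E[p^{k+1}] ↪ E[p^{k+2}] ∘ (P ↦ p·P) = p·`;
* **`WeierstrassCurve.eisensteinTowerReadout W κ hm … : AdicTower.H1A (W.eisensteinTower (κ.unitTwist (-1)) hm) … →+
  H¹(K_∞, E[p^∞])`** (`(W.baseChange K).subgroupH1 p κ.kerSubgroup`, the ambient group of `Sel_{p^∞}(E/K_∞) = W.selmerInfty κ`): Howard's map
  `H¹(K, A_𝔮) → H¹(K_∞, E[p^∞])` for `𝔮 = ((γ-1)^m + p)`, all dictionary hypotheses discharged;
* **`psi_apply_eisensteinTowerReadout_eq_zero`**: its image is killed by `(conj_γ − 1)^m + p` (`γ` a topological generator of `κ`);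
* **`eq_zero_of_eisensteinTowerReadout_eq_zero`**: it is injective as soon as the `E[p^k]` have no `Gal(K̄/K_∞)`-fixed points and
  the coefficient maps `H¹(K_∞, E[p^{k+1}]) → H¹(K_∞, E[p^∞])` are injective (both from `E(K_∞)[p] = 0`).

References: [Howard2004HeegnerKolyvagin] §2.2, proof of Thm. 2.2.10, Prop. 3.2.8; [GreenbergLNM1716] §4 pp. 107, 124.
BSD is not proved by any of this.
-/

noncomputable section

open Literature.NumberTheory.EllipticCurves Literature.NumberTheory.GaloisRepresentations Field
open Literature.NumberTheory.GaloisCohomology.Howard2004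
open Literature.NumberTheory.EllipticCurves.ZpExtension (EisensteinLevel)
open IwasawaAlgebra IwasawaAlgebra.EisensteinCoeff IwasawaAlgebra.EisensteinCoeff.TwistedBy
open scoped ContRepresentation

namespace WeierstrassCurve

section TorsionLemmas

variable {L : Type} [Field L] (V : WeierstrassCurve L) (p : ℕ)

/-- `p^k · E[p^k] = 0`. [cite: SilvermanAEC2009, Cor. III.6.4] -/
theorem geomTorsion_pow_nsmul_eq_zero (k : ℕ) (a : geomTorsion V ((p : ℤ) ^ k)) : p ^ k • a = 0 := by
  apply Subtype.ext
  have h := (mem_geomTorsion_iff V _ (a : geomPoints V)).1 a.2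
  rw [AddSubgroupClass.coe_nsmul, ZeroMemClass.coe_zero, ← natCast_zsmul, Nat.cast_pow]
  exact h

/-- `E[p^{k+1}] ↪ E[p^{k+2}]` after `P ↦ p·P : E[p^{k+2}] → E[p^{k+1}]` is multiplication by `p` on `E[p^{k+2}]`.
[cite: SilvermanAEC2009, Cor. III.6.4] -/
theorem torsionIncl_torsionGaloisModuleReduce (k : ℕ) (P : geomTorsion V ((p : ℤ) ^ (k + 1 + 1))) :
    AddSubgroup.inclusion (geomTorsion_le_of_dvd V (pow_dvd_pow (p : ℤ) (Nat.le_succ (k + 1))))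
        (V.torsionGaloisModuleReduce p (k + 1) P) = p • P := by
  apply Subtype.ext
  change (p : ℤ) • (P : geomPoints V) = ((p • P : geomTorsion V ((p : ℤ) ^ (k + 1 + 1))) : geomPoints V)
  rw [AddSubgroupClass.coe_nsmul, natCast_zsmul]

end TorsionLemmas

variable {K : Type} [Field K] [NumberField K] (W : WeierstrassCurve ℚ) [W.IsElliptic] {p : ℕ} [hp : Fact p.Prime]
  (κ : ZpExtension K p) {m : ℕ} (hm : 1 ≤ m)

variable (π : IwasawaAlgebra p ⧸ Ideal.span {(PowerSeries.X ^ m + PowerSeries.C (p : ℤ_[p]) : IwasawaAlgebra p)})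
  (e : ℕ → ℕ)
  (hkill : letI := IwasawaAlgebra.isLocalRing_quotient_X_pow_add_C p hm
    ∀ k, ∀ r ∈ IsLocalRing.maximalIdeal
      (IwasawaAlgebra p ⧸ Ideal.span {(PowerSeries.X ^ m + PowerSeries.C (p : ℤ_[p]) : IwasawaAlgebra p)}) ^ e k,
      ∀ x : EisensteinLevel p m (fun j ↦ geomTorsion (W.baseChange K) ((p : ℤ) ^ j)) (k + 1), r • x = 0)
  (hker : letI := IwasawaAlgebra.isLocalRing_quotient_X_pow_add_C p hm
    ∀ k, LinearMap.ker ((W.eisensteinTower (κ.unitTwist (-1)) hm).red k) =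
      (IsLocalRing.maximalIdeal
        (IwasawaAlgebra p ⧸ Ideal.span {(PowerSeries.X ^ m + PowerSeries.C (p : ℤ_[p]) : IwasawaAlgebra p)}) ^ e k) •
        (⊤ : Submodule (IwasawaAlgebra p ⧸ Ideal.span {(PowerSeries.X ^ m + PowerSeries.C (p : ℤ_[p]) : IwasawaAlgebra p)})
          (EisensteinLevel p m (fun j ↦ geomTorsion (W.baseChange K) ((p : ℤ) ^ j)) (k + 1 + 1))))
  (hπ : letI := IwasawaAlgebra.isLocalRing_quotient_X_pow_add_C p hm
    π ∈ IsLocalRing.maximalIdeal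
      (IwasawaAlgebra p ⧸ Ideal.span {(PowerSeries.X ^ m + PowerSeries.C (p : ℤ_[p]) : IwasawaAlgebra p)}))
  (he : ∀ k, e k ≤ e (k + 1))
  (hπX : π = Ideal.Quotient.mk _ PowerSeries.X) (hek : ∀ k, e (k + 1) - e k = m)

/-- **Howard's readout `H¹(K, A_𝔮) →+ H¹(K_∞, E[p^∞])` for the curve** (`A_𝔮 = colim_k E_K[p^{k+1}] ⊗ A_{m,k+1}(ψ⁻¹)`,
D1's `W.eisensteinTower (κ.unitTwist (-1)) hm`, `AdicTower.H1A`): the generic `eisensteinTowerReadout` with every dictionary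
hypothesis discharged (`χ_k = eisensteinTwistChar`, `hact`, `hχker`, `p^k E[p^k] = 0`, coefficient maps the inclusions
`E[p^{k+1}] ↪ E[p^∞]`, transition maps `E[p^{k+1}] ↪ E[p^{k+2}]`). Its values lie in `(W.baseChange K).subgroupH1 p κ.kerSubgroup`, the
ambient group of `Sel_{p^∞}(E/K_∞)`. [cite: Howard2004HeegnerKolyvagin, §2.2, proof of Thm. 2.2.10 and Prop. 3.2.8]
[cite: GreenbergLNM1716, §4 p. 124] -/
def eisensteinTowerReadout :
    letI := IwasawaAlgebra.isLocalRing_quotient_X_pow_add_C p hm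
    AdicTower.H1A (W.eisensteinTower (κ.unitTwist (-1)) hm) π e hkill hker hπ he →+ (W.baseChange K).subgroupH1 p κ.kerSubgroup :=
  (κ.unitTwist (-1)).eisensteinTowerReadout
    (fun j ↦ (W.baseChange K).torsionGaloisModule ((p : ℤ) ^ j)) (fun j ↦ (W.baseChange K).torsionGaloisModuleReduce p j) hm
    (fun j ↦ (W.baseChange K).torsionGaloisModuleReduce_surjective p j) κ
    (fun k ↦ (κ.unitTwist (-1)).eisensteinTwistChar hm k)
    (fun k σ x ↦ (κ.unitTwist (-1)).eisensteinTwist_torsionGaloisModule_apply hm k (W.baseChange K) _ σ x)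
    (fun k a ↦ (W.baseChange K).geomTorsion_pow_nsmul_eq_zero p k a)
    (fun k _ hσ ↦ κ.eisensteinTwistChar_unitTwist_eq_one_of_mem_kerSubgroup hm k (-1) hσ)
    (N := geomPrimaryTorsion (W.baseChange K) p)
    (fun k ↦ AddSubgroup.inclusion (AcSigned.geomTorsion_zpow_le_geomPrimaryTorsion (W.baseChange K) p (k + 1)))
    (fun _ _ _ ↦ rfl)
    (fun k ↦ AddSubgroup.inclusion (geomTorsion_le_of_dvd (W.baseChange K) (pow_dvd_pow (p : ℤ) (Nat.le_succ (k + 1)))))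
    (fun _ _ _ ↦ rfl) (fun k P ↦ (W.baseChange K).torsionIncl_torsionGaloisModuleReduce p k P) (fun _ _ ↦ rfl)
    π e hkill hker hπ he hπX hek

/-- **The image of `H¹(K, A_𝔮) → H¹(K_∞, E[p^∞])` is killed by `ψ_m = (conj_γ − 1)^m + p`** for a topological generator `γ` of
`κ` (`θ` any endomorphism agreeing with `conj_γ`, e.g. the `T+1`-action of `SelmerDualData`): the hypothesis `hι` of the
μ-glue `exists_linearMap_quotSMulTop_qm_characterModule`. [cite: Howard2004HeegnerKolyvagin, §2.2, proof of Thm. 2.2.10 and Prop. 3.2.8]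
[cite: GreenbergLNM1716, §4 pp. 107, 124] -/
theorem psi_apply_eisensteinTowerReadout_eq_zero {γ : absoluteGaloisGroup K} (hγ : κ.IsTopGenerator γ)
    (θ : AddMonoid.End ((W.baseChange K).subgroupH1 p κ.kerSubgroup))
    (hθ : ∀ c, θ c = (W.baseChange K).conjH1 p κ.kerSubgroup γ c) :
    letI := IwasawaAlgebra.isLocalRing_quotient_X_pow_add_C p hm
    ∀ x : AdicTower.H1A (W.eisensteinTower (κ.unitTwist (-1)) hm) π e hkill hker hπ he,
      ((θ - 1) ^ m + (p : AddMonoid.End ((W.baseChange K).subgroupH1 p κ.kerSubgroup)))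
        (W.eisensteinTowerReadout κ hm π e hkill hker hπ he hπX hek x) = 0 :=
  (κ.unitTwist (-1)).psi_apply_eisensteinTowerReadout_eq_zero _ _ hm _ κ _ _ _ _ _ _ _ _ _ _ π e hkill hker hπ he hπX hek
    (fun k ↦ κ.eisensteinTwistChar_unitTwist_neg_one_mul_onePlusT hm k hγ) (fun _ _ _ ↦ rfl) θ hθ

/-- **Injectivity of `H¹(K, A_𝔮) → H¹(K_∞, E[p^∞])`**, given that the `E[p^k]` have no `Gal(K̄/K_∞)`-fixed points and the
coefficient maps `H¹(K_∞, E[p^{k+1}]) → H¹(K_∞, E[p^∞])` are injective (both consequences of `E(K_∞)[p] = 0`).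
[cite: Howard2004HeegnerKolyvagin, §2.2, proof of Thm. 2.2.10 and Lemma 3.2.9] [cite: GreenbergLNM1716, §4 p. 124] -/
theorem eq_zero_of_eisensteinTowerReadout_eq_zero {γ : absoluteGaloisGroup K} (hγ : κ.IsTopGenerator γ)
    (hfix : ∀ (k : ℕ) (a : geomTorsion (W.baseChange K) ((p : ℤ) ^ k)), (∀ σ ∈ κ.kerSubgroup, σ • a = a) → a = 0)
    (hjinj : ∀ k : ℕ, Function.Injective (resH1Hom (ContinuousMonoidHom.id κ.kerSubgroup)
      (AddSubgroup.inclusion (AcSigned.geomTorsion_zpow_le_geomPrimaryTorsion (W.baseChange K) p (k + 1)))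
      (fun _ _ ↦ rfl))) :
    letI := IwasawaAlgebra.isLocalRing_quotient_X_pow_add_C p hm
    ∀ x : AdicTower.H1A (W.eisensteinTower (κ.unitTwist (-1)) hm) π e hkill hker hπ he,
      W.eisensteinTowerReadout κ hm π e hkill hker hπ he hπX hek x = 0 → x = 0 :=
  (κ.unitTwist (-1)).eq_zero_of_eisensteinTowerReadout_eq_zero _ _ hm _ κ _ _ _ _ _ _ _ _ _ _ π e hkill hker hπ he hπX hek
    (fun k ↦ κ.eisensteinTwistChar_unitTwist_neg_one_mul_onePlusT hm k hγ) hfix hjinj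

end WeierstrassCurve
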